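import Literature.NumberTheory.NumberFields.GassmannPermChar
import HarnessLib

/-!
# Two actions with the same permutation character, degree `≤ 6`: the case of two orbits

Topic `NumberTheory/NumberFields`; theorem-only file (D-0026), second of four files on the
group theory of Perlis's Theorem 3 [Perlis1977, §4] (see `GassmannPermChar` for the overview).

Setting of this and the next two files: a finite group `G` acts on finite sets `X` and `X'` with
`#X = #X' ≤ 6`, faithfully on both, with the same permutation character
`#Fix_X(g) = #Fix_{X'}(g)` (hypotheses `hc`, `hf`, `hf'`, `hfix`; for `X = G/H`, `X' = G/H'` this is
Gassmann equivalence of `H, H'` made faithful).  Fix `x₀' ∈ X'` and a subgroup `S ≤ Stab(x₀')`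
fixing NO point of `X`; let `r` be its number of orbits on `X'` (= on `X`, by Burnside).  Then
`2 ≤ r ≤ 3` and `2r ≤ #X` (`card_quotient_bounds`), and **`r = 2` is impossible**
(`false_of_card_quotient_eq_two`): for `#X ∈ {4, 6}` an element of prime order `#X - 1` of `S`
would act trivially on `X`; for `#X = 5` the orbits `2 + 3` on `X` and `1 + 4` on `X'` force
`#S = 12` with a central involution whose fixed points on `X'` contradict the `4`-orbit
(`false_of_card_eq_five`).  This replaces the enumeration of transitive groups of degree `≤ 6`
in [Perlis1977, §4] by a classification-free argument.

## References

* [Perlis1977] R. Perlis, *On the equation `ζ_K(s) = ζ_{K'}(s)`*, J. Number Theory 9 (1977),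
  342–360: §1 Lemma 1 (Gassmann equivalence via coset types), §4 Theorems 2–3 (pp. 353–358).
* F. Gassmann, *Bemerkungen zu der vorstehenden Arbeit von Hurwitz*, Math. Z. 25 (1926), 124–143
  (cited through Perlis).
-/

noncomputable section

open MulAction Subgroup
open scoped Pointwise

namespace Literature.NumberTheory.NumberFields

namespace Gassmann

/-! ### Two actions with the same permutation character -/

section TwoActions

variable {G : Type*} [Group G] {X X' : Type*} [MulAction G X] [MulAction G X']

/-- The orbit of `x₀'` under a subgroup fixing it is `{x₀'}`. [folklore] -/
theorem orbit_eq_singleton {S : Subgroup G} {x₀' : X'} (hS : S ≤ stabilizer G x₀') :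
    orbit S x₀' = {x₀'} := by
  ext z
  simp only [Set.mem_singleton_iff]
  constructor
  · rintro ⟨s, rfl⟩
    exact mem_stabilizer_iff.mp (hS s.2)
  · rintro rfl
    exact mem_orbit_self _

/-- If `S` fixes no point of `X`, all its orbits on `X` have at least two points. [folklore] -/
theorem two_le_ncard_orbit [Finite X] {S : Subgroup G} (hno : ∀ x : X, ∃ g ∈ S, g • x ≠ x)
    (x : X) : 2 ≤ (orbit S x).ncard := by
  obtain ⟨g, hg, hgx⟩ := hno x
  exact (Set.one_lt_ncard_iff).mpr ⟨(⟨g, hg⟩ : S) • x, x, mem_orbit x _, mem_orbit_self x, hgx⟩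

variable [Finite G] [Finite X] [Finite X']

/-- Every subgroup has as many orbits on `X` as on `X'` (Burnside). [folklore] -/
theorem card_quotient_eq
    (hfix : ∀ g : G, Nat.card (fixedBy X g) = Nat.card (fixedBy X' g)) (S : Subgroup G) :
    Nat.card (orbitRel.Quotient S X) = Nat.card (orbitRel.Quotient S X') := by
  have h1 := finsum_card_fixedBy_eq (S := S) (Y := X)
  have h2 := finsum_card_fixedBy_eq (S := S) (Y := X')
  have h3 : ∑ᶠ s : S, Nat.card (fixedBy X s) = ∑ᶠ s : S, Nat.card (fixedBy X' s) :=
    finsum_congr fun s => hfix (s : G)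
  rw [h1, h2] at h3
  exact Nat.eq_of_mul_eq_mul_right Nat.card_pos h3

omit [Finite G] in
/-- With exactly two orbits of `S ≤ Stab(x₀')` on `X'`, the orbit of any `y ≠ x₀'` is
`X' ∖ {x₀'}`. [folklore] -/
theorem orbit_eq_compl_singleton {S : Subgroup G} {x₀' : X'} (hS : S ≤ stabilizer G x₀')
    (hr : Nat.card (orbitRel.Quotient S X') = 2) {y : X'} (hy : y ≠ x₀') :
    orbit S y = {x₀'}ᶜ := by
  have := orbit_eq_compl_of_card_quotient hr (y := x₀') (z := y)
    (by rw [orbit_eq_singleton hS]; simpa using hy)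
  rwa [orbit_eq_singleton hS] at this

/-- Numerics of the orbit count `r` of `S ≤ Stab(x₀')` (on `X'`, equivalently on `X`) when `S`
fixes no point of `X` and `#X ≤ 6`: `2 ≤ r ≤ 3`, `2r ≤ #X`, and every orbit on `X` has at most
`#X - 2(r-1)` points. [folklore] -/
theorem card_quotient_bounds (hc : Nat.card X = Nat.card X')
    (hfix : ∀ g : G, Nat.card (fixedBy X g) = Nat.card (fixedBy X' g))
    (hn : Nat.card X ≤ 6) {S : Subgroup G} {x₀' : X'} (hS : S ≤ stabilizer G x₀')
    (hno : ∀ x : X, ∃ g ∈ S, g • x ≠ x) :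
    2 ≤ Nat.card (orbitRel.Quotient S X') ∧ Nat.card (orbitRel.Quotient S X') ≤ 3 ∧
    2 * Nat.card (orbitRel.Quotient S X') ≤ Nat.card X ∧
    ∀ x : X, (orbit S x).ncard + 2 * (Nat.card (orbitRel.Quotient S X') - 1) ≤ Nat.card X := by
  have hrX : Nat.card (orbitRel.Quotient S X) = Nat.card (orbitRel.Quotient S X') :=
    card_quotient_eq hfix S
  have hX'pos : 0 < Nat.card X' := Finite.card_pos_iff.mpr ⟨x₀'⟩
  haveI : Nonempty X := Finite.card_pos_iff.mp (hc ▸ hX'pos)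
  obtain ⟨x⟩ := (inferInstance : Nonempty X)
  have hbound : ∀ x : X, (orbit S x).ncard + 2 * (Nat.card (orbitRel.Quotient S X') - 1) ≤
      Nat.card X := fun x => hrX ▸ ncard_orbit_add_le (two_le_ncard_orbit hno) x
  have hrpos : 0 < Nat.card (orbitRel.Quotient S X') :=
    Finite.card_pos_iff.mpr ⟨Quotient.mk'' x₀'⟩
  have h2r : 2 * Nat.card (orbitRel.Quotient S X') ≤ Nat.card X := by
    have := hbound x
    have := two_le_ncard_orbit hno x
    omega
  refine ⟨?_, by omega, h2r, hbound⟩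
  by_contra hr
  have hr1 : Nat.card (orbitRel.Quotient S X') = 1 := by omega
  haveI : Subsingleton (orbitRel.Quotient S X') := (Nat.card_eq_one_iff_unique.mp hr1).1
  have hsub : ∀ y : X', y = x₀' := by
    intro y
    have hy : (Quotient.mk'' y : orbitRel.Quotient S X') = Quotient.mk'' x₀' :=
      Subsingleton.elim _ _
    rw [mk_eq_mk_iff, orbit_eq_singleton hS] at hy
    exact hy
  haveI : Subsingleton X' := ⟨fun a b => (hsub a).trans (hsub b).symm⟩
  have : Nat.card X' ≤ 1 := Finite.card_le_one_iff_subsingleton.mpr inferInstance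
  omega

/-- **Case `r = 2`, `#X - 1` prime** (`#X = 4` or `6`): `S` has an element of prime order
`#X - 1`, which must fix every orbit on `X` (all of size `≤ #X - 2`) — contradicting
faithfulness. [folklore] -/
theorem false_of_card_quotient_eq_two_of_prime (hc : Nat.card X = Nat.card X')
    (hf : ∀ g : G, (∀ x : X, g • x = x) → g = 1)
    (hfix : ∀ g : G, Nat.card (fixedBy X g) = Nat.card (fixedBy X' g))
    (hn : Nat.card X ≤ 6) {S : Subgroup G} {x₀' : X'} (hS : S ≤ stabilizer G x₀')
    (hno : ∀ x : X, ∃ g ∈ S, g • x ≠ x) (hr : Nat.card (orbitRel.Quotient S X') = 2)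
    (hq : (Nat.card X - 1).Prime) : False := by
  obtain ⟨-, -, h2r, hbound⟩ := card_quotient_bounds hc hfix hn hS hno
  rw [hr] at h2r hbound
  -- the orbit `X' ∖ {x₀'}` gives `#X - 1 ∣ #S`
  have hnt : 1 < Nat.card X' := by rw [← hc]; omega
  haveI := Finite.one_lt_card_iff_nontrivial.mp hnt
  obtain ⟨y, hy⟩ := exists_ne x₀'
  have horby : orbit S y = {x₀'}ᶜ := orbit_eq_compl_singleton hS hr hy
  have hdvd : (Nat.card X - 1) ∣ Nat.card S := by
    have h1 : (orbit S y).ncard ∣ Nat.card S := by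
      rw [← index_stabilizer]; exact index_dvd_card _
    have hcc := Set.ncard_add_ncard_compl ({x₀'} : Set X')
    rw [Set.ncard_singleton, ← horby, ← hc] at hcc
    have e : (orbit S y).ncard = Nat.card X - 1 := by omega
    rwa [e] at h1
  haveI := Fact.mk hq
  obtain ⟨s, hs⟩ := exists_prime_orderOf_dvd_card' (G := S) (Nat.card X - 1) hdvd
  have hsfix : ∀ x : X, s • x = x := fun x =>
    smul_eq_of_ncard_orbit_lt hq hs x (by have := hbound x; omega)
  have hs1 : s = 1 := Subtype.ext (hf (s : G) hsfix)
  rw [hs1, orderOf_one] at hs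
  omega

/-- **Case `r = 2`, `#X = 5`**, the core: orbits of sizes `2` and `3` on `X` and an orbit of
size `4` on `X'` force `#S = 12` with a central involution `k` acting trivially exactly on the
`3`-orbit; then `Fix_{X'}(k) ∖ {x₀'}` is an `S`-stable `2`-set inside the `4`-orbit.
[folklore] -/
theorem false_of_card_eq_five (hc : Nat.card X = Nat.card X')
    (hf : ∀ g : G, (∀ x : X, g • x = x) → g = 1)
    (hfix : ∀ g : G, Nat.card (fixedBy X g) = Nat.card (fixedBy X' g))
    {S : Subgroup G} {x₀' : X'} (hS : S ≤ stabilizer G x₀') (h5 : Nat.card X = 5)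
    (horb' : ∀ y : X', y ≠ x₀' → orbit S y = {x₀'}ᶜ) (x₂ x₃ : X)
    (h2 : (orbit S x₂).ncard = 2) (h3 : (orbit S x₃).ncard = 3)
    (hcov : orbit S x₃ = (orbit S x₂)ᶜ) : False := by
  classical
  have h5' : Nat.card X' = 5 := hc ▸ h5
  -- `12 ∣ #S`
  have h3dvd : 3 ∣ Nat.card S := by
    rw [← h3, ← index_stabilizer]; exact index_dvd_card _
  have hnt : 1 < Nat.card X' := by omega
  haveI := Finite.one_lt_card_iff_nontrivial.mp hnt
  obtain ⟨y₁, hy₁⟩ := exists_ne x₀'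
  have h4dvd : 4 ∣ Nat.card S := by
    have h1 : (orbit S y₁).ncard ∣ Nat.card S := by
      rw [← index_stabilizer]; exact index_dvd_card _
    have hcc := Set.ncard_add_ncard_compl ({x₀'} : Set X')
    rw [Set.ncard_singleton, ← horb' y₁ hy₁, h5'] at hcc
    have e : (orbit S y₁).ncard = 4 := by omega
    rwa [e] at h1
  have h12 : 12 ∣ Nat.card S :=
    Nat.Coprime.mul_dvd_of_dvd_of_dvd (by norm_num : Nat.Coprime 3 4) h3dvd h4dvd
  -- the action of `S` on the `3`-orbit
  let φ : S →* Equiv.Perm (orbit S x₃) := MulAction.toPermHom S (orbit S x₃)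
  have hker_fix : ∀ k ∈ φ.ker, ∀ w ∈ orbit S x₃, k • w = w := by
    intro k hk w hw
    have := congrArg (fun e : Equiv.Perm (orbit S x₃) => ((e ⟨w, hw⟩ : orbit S x₃) : X))
      (MonoidHom.mem_ker.mp hk)
    simpa [φ] using this
  have hmem2 : ∀ w : X, w ∉ orbit S x₃ → w ∈ orbit S x₂ := by
    intro w hw
    rw [hcov] at hw
    simpa using hw
  -- `#ker φ ≤ 2`
  have hker_le : Nat.card φ.ker ≤ 2 := by
    let ι : φ.ker → orbit S x₂ := fun k => ⟨(k : S) • x₂, mem_orbit x₂ (k : S)⟩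
    have hι : Function.Injective ι := by
      intro k k' hkk'
      have e1 : (k : S) • x₂ = (k' : S) • x₂ := congrArg Subtype.val hkk'
      have hu : ((k : S)⁻¹ * (k' : S)) • x₂ = x₂ := by rw [mul_smul, ← e1, inv_smul_smul]
      have hu_mem : ((k : S)⁻¹ * (k' : S)) ∈ φ.ker := φ.ker.mul_mem (φ.ker.inv_mem k.2) k'.2
      have hall : ∀ w : X, ((k : S)⁻¹ * (k' : S)) • w = w := by
        intro w
        by_cases hw : w ∈ orbit S x₃
        · exact hker_fix _ hu_mem w hw
        · exact smul_eq_of_ncard_orbit_eq_two h2 hu (hmem2 w hw)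
      have hone : (k : S)⁻¹ * (k' : S) = 1 := Subtype.ext (hf _ hall)
      exact Subtype.ext (inv_mul_eq_one.mp hone)
    have := Nat.card_le_card_of_injective ι hι
    rwa [Nat.card_coe_set_eq, h2] at this
  -- `#range φ ≤ 6`
  have hrange_le : Nat.card φ.range ≤ 6 := by
    have hperm : Nat.card (Equiv.Perm (orbit S x₃)) = 6 := by
      letI : Fintype (orbit S x₃) := Fintype.ofFinite _
      rw [Nat.card_eq_fintype_card, Fintype.card_perm, ← Nat.card_eq_fintype_card,
        Nat.card_coe_set_eq, h3]
      rfl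
    exact hperm ▸ Subgroup.card_le_card_group φ.range
  have hmul : Nat.card φ.ker * Nat.card φ.range = Nat.card S := by
    rw [← Subgroup.index_ker, Subgroup.card_mul_index]
  have hSpos : 0 < Nat.card S := Nat.card_pos
  have h12le : 12 ≤ Nat.card S := Nat.le_of_dvd hSpos h12
  have hker2 : Nat.card φ.ker = 2 := by
    rcases Nat.lt_or_ge (Nat.card φ.ker) 2 with hlt | hge
    · exfalso
      have : Nat.card S ≤ 6 := by
        rw [← hmul]
        calc Nat.card φ.ker * Nat.card φ.range ≤ 1 * 6 := Nat.mul_le_mul (by omega) hrange_le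
          _ = 6 := by norm_num
      omega
    · omega
  -- a nontrivial element `k` of the kernel; it is central in `S`
  obtain ⟨k, hk, hk1⟩ : ∃ k : S, k ∈ φ.ker ∧ k ≠ 1 := by
    have hne : φ.ker ≠ ⊥ := by
      intro hbot; rw [hbot, Subgroup.card_bot] at hker2; omega
    obtain ⟨k, hk⟩ := (Subgroup.ne_bot_iff_exists_ne_one).mp hne
    exact ⟨k, k.2, fun h1 => hk (Subtype.ext h1)⟩
  have hcomm : ∀ s : S, s * k = k * s := by
    intro s
    have hmem : s * k * s⁻¹ ∈ φ.ker := (inferInstance : φ.ker.Normal).conj_mem k hk s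
    have hne : s * k * s⁻¹ ≠ 1 := by
      intro h1
      apply hk1
      have h2' : s * k = s := (mul_inv_eq_iff_eq_mul.mp h1).trans (one_mul s)
      exact mul_eq_left.mp h2'
    have heq := eq_of_card_eq_two hker2 hmem hk hne hk1
    calc s * k = s * k * s⁻¹ * s := by group
      _ = k * s := by rw [heq]
  -- `Fix_X(k)` is exactly the `3`-orbit
  have hfixX : fixedBy X (k : G) = orbit S x₃ := by
    ext w
    rw [mem_fixedBy]
    constructor
    · intro hw
      by_contra hw3
      have hw2 : w ∈ orbit S x₂ := hmem2 w hw3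
      apply hk1
      apply Subtype.ext
      apply hf
      intro v
      by_cases hv : v ∈ orbit S x₃
      · exact hker_fix k hk v hv
      · have hv2 : v ∈ orbit S x₂ := hmem2 v hv
        have horbw : orbit S w = orbit S x₂ := orbit_eq_iff.mpr hw2
        have h2w : (orbit S w).ncard = 2 := by rw [horbw]; exact h2
        exact smul_eq_of_ncard_orbit_eq_two h2w hw (by rw [horbw]; exact hv2)
    · intro hw
      exact hker_fix k hk w hw
  have hfix3 : Nat.card (fixedBy X' (k : G)) = 3 := by
    rw [← hfix, Nat.card_coe_set_eq, hfixX, h3]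
  -- `F = Fix_{X'}(k) ∖ {x₀'}` is an `S`-stable `2`-set containing a `4`-orbit
  have hx₀' : x₀' ∈ fixedBy X' (k : G) := mem_stabilizer_iff.mp (hS k.2)
  have hF : (fixedBy X' (k : G) \ {x₀'}).ncard = 2 := by
    rw [Set.ncard_sdiff_singleton_of_mem hx₀', ← Nat.card_coe_set_eq, hfix3]
  obtain ⟨y, hyF⟩ : (fixedBy X' (k : G) \ {x₀'}).Nonempty :=
    Set.nonempty_of_ncard_ne_zero (by rw [hF]; norm_num)
  have hy0 : y ≠ x₀' := fun hyx => hyF.2 (by simp [hyx])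
  have horby : orbit S y = {x₀'}ᶜ := horb' y hy0
  have hsub : orbit S y ⊆ fixedBy X' (k : G) \ {x₀'} := by
    rintro _ ⟨s, rfl⟩
    constructor
    · rw [mem_fixedBy]
      have hky : (k : G) • y = y := hyF.1
      show (k : G) • ((s : G) • y) = (s : G) • y
      rw [smul_smul, ← Subgroup.coe_mul, ← hcomm s, Subgroup.coe_mul, mul_smul, hky]
    · intro hsy
      apply hy0
      have hsy' : (s : G) • y = x₀' := hsy
      calc y = (s : G)⁻¹ • ((s : G) • y) := (inv_smul_smul _ _).symm
        _ = (s : G)⁻¹ • x₀' := by rw [hsy']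
        _ = x₀' := mem_stabilizer_iff.mp (hS (S.inv_mem s.2))
  have hle := Set.ncard_le_ncard hsub
  rw [horby, hF] at hle
  have hcc := Set.ncard_add_ncard_compl ({x₀'} : Set X')
  rw [Set.ncard_singleton, h5'] at hcc
  omega

/-- **Case `r = 2` is impossible.** [folklore] -/
theorem false_of_card_quotient_eq_two (hc : Nat.card X = Nat.card X')
    (hf : ∀ g : G, (∀ x : X, g • x = x) → g = 1)
    (hfix : ∀ g : G, Nat.card (fixedBy X g) = Nat.card (fixedBy X' g))
    (hn : Nat.card X ≤ 6) {S : Subgroup G} {x₀' : X'} (hS : S ≤ stabilizer G x₀')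
    (hno : ∀ x : X, ∃ g ∈ S, g • x ≠ x) (hr : Nat.card (orbitRel.Quotient S X') = 2) :
    False := by
  obtain ⟨-, -, h2r, hbound⟩ := card_quotient_bounds hc hfix hn hS hno
  rw [hr] at h2r hbound
  have hcases : Nat.card X = 4 ∨ Nat.card X = 5 ∨ Nat.card X = 6 := by omega
  rcases hcases with h4 | h5 | h6
  · exact false_of_card_quotient_eq_two_of_prime hc hf hfix hn hS hno hr
      (by rw [h4]; exact Nat.prime_three)
  · -- orbits of sizes `2` and `3` on `X`
    have hrX : Nat.card (orbitRel.Quotient S X) = 2 := (card_quotient_eq hfix S).trans hr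
    have horb' : ∀ y : X', y ≠ x₀' → orbit S y = {x₀'}ᶜ := fun y hy =>
      orbit_eq_compl_singleton hS hr hy
    haveI : Nonempty X := Finite.card_pos_iff.mp (by omega : 0 < Nat.card X)
    obtain ⟨x⟩ := (inferInstance : Nonempty X)
    have hxlt : (orbit S x).ncard < (Set.univ : Set X).ncard := by
      rw [Set.ncard_univ]; have := hbound x; omega
    obtain ⟨z, -, hz⟩ := Set.exists_mem_notMem_of_ncard_lt_ncard hxlt
    have horbz : orbit S z = (orbit S x)ᶜ := orbit_eq_compl_of_card_quotient hrX hz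
    have hsum : (orbit S x).ncard + (orbit S z).ncard = 5 := by
      rw [horbz, Set.ncard_add_ncard_compl, h5]
    have hx2 := two_le_ncard_orbit hno x
    have hz2 := two_le_ncard_orbit hno z
    rcases (by omega : (orbit S x).ncard = 2 ∨ (orbit S x).ncard = 3) with hx | hx
    · exact false_of_card_eq_five hc hf hfix hS h5 horb' x z hx (by omega) horbz
    · refine false_of_card_eq_five hc hf hfix hS h5 horb' z x (by omega) hx ?_
      rw [horbz, compl_compl]
  · exact false_of_card_quotient_eq_two_of_prime hc hf hfix hn hS hno hr
      (by rw [h6]; exact Nat.prime_five)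

end TwoActions

end Gassmann

end Literature.NumberTheory.NumberFields
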